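import Summits.QuantumFields.QCD.Theses.SmallBetaInfraredSplit
import Summits.QuantumFields.QCD.Theorems.SmallBetaInfraredSplitTwoPointKernelStructure
import Summits.Ventures.YMGap.Conjectures.StrongCouplingChiralLROSchwingerDysonSmallBeta

/-!
# Route `SmallBetaInfraredSplit` (sub QCD) — crux `NeighbourFloorSmallBeta` (stmt-QuantumFields-27241), PROVED

The β-stable Schwinger–Dyson nearest-neighbour floor at `m = 0`: for `1 ≤ N ≤ 4`, `ν ≥ 4` there are
`β₀ > 0`, `C ≥ 0`, `L₀` with `(2N)²(1/K(N) − Cβ) ≤ |Λ|⁻¹ Σ_x Σ_μ (G_β(x,x+e_μ) + G_β(x,x−e_μ))` for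
`0 ≤ β < β₀` and even `L ≥ L₀`, `K(N) = sdK N (uNLogCoeff N)`.

Proof (following the hint of cell `pub-ymgap`, literature-prover seat qcd-lit g22: «a mean-value estimate on
`sdBound` would give it»):
* the venture's volume-free Schwinger–Dyson constant `b(β) = sdBound N ν β` bounds the nearest-neighbour sum at
  the origin from below at EVERY `β ≥ 0` with `κ(β) < N e^{−βc}` and on EVERY even torus
  (`SchwingerDyson.schwingerDyson_bound`, tree), and `b(0) = (2N)²/K(N)` (`sdBound_zero`);
* `β ↦ b(β)` is DIFFERENTIABLE at `0` (`differentiableAt_sdBound`: a rational expression in `e^{βc}` and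
  `κ(β)` through the rates `λ_j(β)`, the products `P_n`, the `α_n` and `K(λ(β))`, all denominators being `N` resp.
  `≥ 1` at `β = 0`), hence `b(β) ≥ (2N)²/K(N) − (|b′(0)| + 1)·β` for `0 ≤ β < δ` (`sdBound_linear_lower`, the
  little-o form of the derivative with constant `1`);
* validity `κ(β) < N e^{−βc}` for `β < δ₂` by continuity (`kap_lt_of_small`), and the site average equals the sum
  at the origin by translation invariance of `G_β` (`twoPointKernelStructure_proof`); the route's kernel is the
  venture's `ssTwoPoint N ν L β 0` definitionally.
So `β₀ = min δ δ₂`, `C = (|b′(0)| + 1)/(2N)²`, `L₀ = 2`.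

HONEST FRAMING: with `IRBoundSmallBeta` (27240) this closes every item of the DRAFT-by-design route; its leaf
`SalmhoferSeilerSmallBeta` (LADDER-YM rung Q1, RECORD label) is ALREADY a tree theorem
(`Summit.Ventures.YMGap.Conjectures.salmhoferSeilerSmallBeta_holds`, pub-ymgap).  Nothing about `QCD` (the summit
conjunct), `YangMills`, a mass gap or a continuum limit is proved here.
[cite: SalmhoferSeiler1991, Lemma 4.7, Thm. 4.8 (4.38)–(4.39), Remark 4.6]
-/

set_option autoImplicit false

namespace Summit.QuantumFields.QCD.Theorems.SmallBetaInfraredSplit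

open Finset Filter
open Literature.MathematicalPhysics.QuantumFieldTheory
open Literature.MathematicalPhysics.QuantumLattice
open Literature.MathematicalPhysics.StatisticalMechanics
open Literature.Probability.LatticeModels (TorusSite)
open Summit.Ventures.YMGap.Conjectures
open Summit.Ventures.YMGap.Conjectures.SchwingerDyson
open scoped Topology

section Differentiability

variable {N ν : ℕ}

/-- `κ` is differentiable. [cite: SeilerLNP1982, Ch. 2] -/
theorem differentiableAt_kap (β : ℝ) : DifferentiableAt ℝ (kap N ν) β := by
  unfold kap; fun_prop

/-- The rates `λ_j(β)` are differentiable at `β = 0` (denominator `N ≠ 0` there). [cite: SalmhoferSeiler1991, Lemma 4.7 (4.35)] -/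
theorem differentiableAt_sdLam (hN : N ≠ 0) (j : ℕ) : DifferentiableAt ℝ (fun β => sdLam N ν β j) 0 := by
  unfold sdLam kap
  refine DifferentiableAt.div (by fun_prop) (by fun_prop) ?_
  have hN' : (N : ℝ) ≠ 0 := Nat.cast_ne_zero.mpr hN
  simp [hN']

/-- The products `P_n(k)` of the rates are differentiable at `β = 0`. [cite: SalmhoferSeiler1991, (4.36)] -/
theorem differentiableAt_sdProdP (hN : N ≠ 0) (n k : ℕ) :
    DifferentiableAt ℝ (fun β => ComplexSpin.sdProdP (sdLam N ν β) n k) 0 := by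
  unfold ComplexSpin.sdProdP
  exact DifferentiableAt.fun_finsetProd fun i _ => differentiableAt_sdLam hN _

/-- `α_n(λ(β))` is differentiable at `β = 0` for `n ≤ N` (its denominator is `≥ 1` there).
[cite: SalmhoferSeiler1991, (4.29)] -/
theorem differentiableAt_sdAlphaP (hN1 : 1 ≤ N) (hN4 : N ≤ 4) {n : ℕ} (hn : n ≤ N) :
    DifferentiableAt ℝ (fun β => ComplexSpin.sdAlphaP (sdLam N ν β) (ComplexSpin.uNLogCoeff N) n) 0 := by
  have hN0 : N ≠ 0 := by omega
  unfold ComplexSpin.sdAlphaP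
  refine DifferentiableAt.div ?_ ?_ ?_
  · exact DifferentiableAt.fun_finsetProd fun i _ => differentiableAt_sdLam hN0 _
  · exact (differentiableAt_const _).add
      (DifferentiableAt.fun_sum fun i _ => (differentiableAt_const _).mul (differentiableAt_sdProdP hN0 _ _))
  · have hlam : ∀ j, j ≤ N → 0 ≤ sdLam N ν 0 j := fun j hj => by
      rw [sdLam_zero hN0]; exact ComplexSpin.sdRate_nonneg hN1 hj
    have h1 := ComplexSpin.one_le_sdAlphaP_den (lam := sdLam N ν 0) (w := ComplexSpin.uNLogCoeff N) hlam
      (fun k hk2 hkN => ComplexSpin.uNLogCoeff_nonneg hN4 k hk2 hkN) hn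
    exact ne_of_gt (lt_of_lt_of_le one_pos h1)

/-- `K(λ(β))` is differentiable at `β = 0`. [cite: SalmhoferSeiler1991, Thm. 4.8 (4.39)] -/
theorem differentiableAt_sdKP (hN1 : 1 ≤ N) (hN4 : N ≤ 4) :
    DifferentiableAt ℝ (fun β => ComplexSpin.sdKP N (sdLam N ν β) (ComplexSpin.uNLogCoeff N)) 0 := by
  unfold ComplexSpin.sdKP
  exact DifferentiableAt.fun_sum fun k hk =>
    (differentiableAt_const _).mul (differentiableAt_sdAlphaP hN1 hN4 (Nat.lt_succ_iff.mp (Finset.mem_range.mp hk)))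

/-- `K(N) ≥ 1` for the `U(N)` weights, `1 ≤ N ≤ 4`. [cite: SalmhoferSeiler1991, Remark 4.6] -/
theorem one_le_sdK_uN (hN1 : 1 ≤ N) (hN4 : N ≤ 4) :
    1 ≤ ComplexSpin.sdK N (ComplexSpin.uNLogCoeff N) :=
  ComplexSpin.one_le_sdK hN1 (ComplexSpin.uNLogCoeff_one N)
    fun k hk2 hkN => ComplexSpin.uNLogCoeff_nonneg hN4 k hk2 hkN

/-- **The explicit Schwinger–Dyson constant is differentiable at `β = 0`.** [cite: SalmhoferSeiler1991, Thm. 4.8 (4.38)–(4.39)] -/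
theorem differentiableAt_sdBound (hN1 : 1 ≤ N) (hN4 : N ≤ 4) : DifferentiableAt ℝ (sdBound N ν) 0 := by
  have hN0 : N ≠ 0 := by omega
  have h : sdBound N ν = fun β => (2 * N : ℝ) ^ 2 * (((N : ℝ) - 2 * ν * kap N ν β) /
      ((N : ℝ) * Real.exp (β * linkOsc ν N) * ComplexSpin.sdKP N (sdLam N ν β) (ComplexSpin.uNLogCoeff N) +
        kap N ν β)) := by
    funext β; rfl
  rw [h]
  refine (differentiableAt_const _).mul (DifferentiableAt.div ?_ ?_ ?_)
  · exact (differentiableAt_const _).sub ((differentiableAt_const _).mul (differentiableAt_kap 0))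
  · have hexp : DifferentiableAt ℝ (fun β : ℝ => Real.exp (β * linkOsc ν N)) 0 := by fun_prop
    exact (((differentiableAt_const _).mul hexp).mul (differentiableAt_sdKP hN1 hN4)).add (differentiableAt_kap 0)
  · rw [kap_zero, sdLam_zero hN0, ComplexSpin.sdKP_rate, zero_mul, Real.exp_zero, mul_one, add_zero]
    have hK1 := one_le_sdK_uN hN1 hN4
    have hN' : (0 : ℝ) < N := by exact_mod_cast Nat.pos_of_ne_zero hN0
    positivity

/-- `b(0) = (2N)²/K(N)`. [cite: SalmhoferSeiler1991, Thm. 4.8 (4.38) with Remark 4.6] -/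
theorem sdBound_zero (hN1 : 1 ≤ N) (hN4 : N ≤ 4) :
    sdBound N ν 0 = (2 * N : ℝ) ^ 2 / ComplexSpin.sdK N (ComplexSpin.uNLogCoeff N) := by
  have hN0 : N ≠ 0 := by omega
  have hN' : (N : ℝ) ≠ 0 := Nat.cast_ne_zero.mpr hN0
  have hK1 := one_le_sdK_uN hN1 hN4
  rw [sdBound, kap_zero, sdLam_zero hN0, ComplexSpin.sdKP_rate]
  simp only [mul_zero, sub_zero, zero_mul, Real.exp_zero, mul_one, add_zero]
  field_simp

/-- **Linear lower bound near `β = 0`**: `b(β) ≥ (2N)²/K(N) − C·β` for `0 ≤ β < δ`, with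
`C = |b′(0)| + 1` (little-o form of the derivative). [cite: SalmhoferSeiler1991, Thm. 4.8 (4.38)–(4.39)] -/
theorem sdBound_linear_lower (hN1 : 1 ≤ N) (hN4 : N ≤ 4) :
    ∃ δ : ℝ, 0 < δ ∧ ∃ C : ℝ, 0 ≤ C ∧ ∀ β : ℝ, 0 ≤ β → β < δ →
      (2 * N : ℝ) ^ 2 / ComplexSpin.sdK N (ComplexSpin.uNLogCoeff N) - C * β ≤ sdBound N ν β := by
  have hd := (differentiableAt_sdBound (ν := ν) hN1 hN4).hasDerivAt
  set f' : ℝ := deriv (sdBound N ν) 0 with hf'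
  have hev := (hd.isLittleO).def one_pos
  obtain ⟨δ, hδ, hball⟩ := Metric.eventually_nhds_iff.1 hev
  refine ⟨δ, hδ, |f'| + 1, by positivity, fun β hβ hβδ => ?_⟩
  have hdist : dist β 0 < δ := by rwa [dist_zero_right, Real.norm_eq_abs, abs_of_nonneg hβ]
  have h := hball hdist
  rw [sub_zero, smul_eq_mul, one_mul, Real.norm_eq_abs, Real.norm_eq_abs, abs_of_nonneg hβ,
    sdBound_zero hN1 hN4] at h
  have h1 := (abs_le.1 h).1
  have h2 : -(|f'| * β) ≤ β * f' := by nlinarith [neg_abs_le f', hβ]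
  nlinarith

/-- Validity of the one-link estimates near `β = 0`: `κ(β) < N e^{−βc}` for `0 ≤ β < δ₂`. [cite: SeilerLNP1982, Ch. 2] -/
theorem kap_lt_of_small (hN0 : N ≠ 0) :
    ∃ δ₂ : ℝ, 0 < δ₂ ∧ ∀ β : ℝ, 0 ≤ β → β < δ₂ → kap N ν β < (N : ℝ) * Real.exp (-β * linkOsc ν N) := by
  have hg : Tendsto (fun β => (N : ℝ) * Real.exp (-β * linkOsc ν N) - kap N ν β) (𝓝 0) (𝓝 (N : ℝ)) := by
    have hc : Continuous fun β => (N : ℝ) * Real.exp (-β * linkOsc ν N) - kap N ν β := by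
      have := continuous_kap (N := N) (ν := ν); fun_prop
    have h := hc.tendsto 0
    simpa [kap_zero] using h
  have hNpos : (0 : ℝ) < (N : ℝ) / 2 := by
    have : (0 : ℝ) < N := by exact_mod_cast Nat.pos_of_ne_zero hN0
    positivity
  obtain ⟨δ₂, hδ₂, h₂⟩ := Metric.tendsto_nhds_nhds.mp hg ((N : ℝ) / 2) hNpos
  refine ⟨δ₂, hδ₂, fun β hβ hβδ => ?_⟩
  have hd : dist β 0 < δ₂ := by rwa [dist_zero_right, Real.norm_eq_abs, abs_of_nonneg hβ]
  have hv := h₂ hd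
  rw [Real.dist_eq] at hv
  have := (abs_lt.mp hv).1
  have hκ := kap_nonneg (N := N) (ν := ν) hβ
  linarith

end Differentiability

/-- The route's crux `NeighbourFloorSmallBeta` (stmt-QuantumFields-27241) BY NAME: the β-stable Schwinger–Dyson
nearest-neighbour floor `(2N)²(1/K(N) − Cβ) ≤ |Λ|⁻¹ Σ_x Σ_μ (G_β(x,x+e_μ) + G_β(x,x−e_μ))`, `0 ≤ β < β₀`,
even `L ≥ 2`. [cite: SalmhoferSeiler1991, Thm. 4.8 (4.38)–(4.39) and Remark 4.5] -/
theorem neighbourFloorSmallBeta_proof :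
    Summit.QuantumFields.QCD.Theses.SmallBetaInfraredSplit.NeighbourFloorSmallBeta := by
  intro N ν hN1 hN4 hν
  have hN0 : N ≠ 0 := by omega
  obtain ⟨δ, hδ, C, hC, hlin⟩ := sdBound_linear_lower (ν := ν) hN1 hN4
  obtain ⟨δ₂, hδ₂, hval⟩ := kap_lt_of_small (ν := ν) hN0
  refine ⟨min δ δ₂, lt_min hδ hδ₂, C / (2 * N : ℝ) ^ 2, by positivity, 2, fun β hβ hβ0 L _ hL _ => ?_⟩
  letI : LinearOrder (TorusSite ν L) :=
    LinearOrder.lift' (Fintype.equivFin (TorusSite ν L)) (Fintype.equivFin (TorusSite ν L)).injective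
  haveI : NeZero ν := ⟨by omega⟩
  -- the route's kernel is the venture's `ssTwoPoint N ν L β 0`
  set K : TorusSite ν L → TorusSite ν L → ℝ := fun x y => ssTwoPoint N ν L β 0 x y with hK
  have hKdef : ∀ x y : TorusSite ν L, K x y =
      (∫ U, (Matrix.det (staggeredDirac (unitaryFundamentalRep (Fin N) ℂ) U 0)).re *
        (let G := (staggeredDirac (unitaryFundamentalRep (Fin N) ℂ) U 0)⁻¹
         ((∑ a : Fin N, G (x, a) (x, a)) * (∑ b : Fin N, G (y, b) (y, b)) -
            ∑ a : Fin N, ∑ b : Fin N, G (x, a) (y, b) * G (y, b) (x, a)).re)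
        ∂(wilsonWeight (d := ν) (L := L) (unitaryFundamentalRep (Fin N) ℂ) β)) /
      ∫ U, (Matrix.det (staggeredDirac (unitaryFundamentalRep (Fin N) ℂ) U 0)).re
        ∂(wilsonWeight (d := ν) (L := L) (unitaryFundamentalRep (Fin N) ℂ) β) := fun x y => rfl
  -- translation invariance of the kernel at every `β`
  have hTPK := twoPointKernelStructure_proof N ν hN1 (by omega) L hL.two_dvd β
  dsimp only at hTPK
  obtain ⟨-, hT, -⟩ := hTPK
  have hT' : ∀ x y a, K (x + a) (y + a) = K x y := fun x y a => by rw [hKdef, hKdef]; exact hT a x y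
  have hnn : ∀ x : TorusSite ν L, ∑ μ : Fin ν, (K x (x + Pi.single μ 1) + K x (x - Pi.single μ 1)) =
      ∑ μ : Fin ν, (K (0 : TorusSite ν L) (Pi.single μ 1) + K (0 : TorusSite ν L) (-Pi.single μ 1)) := by
    intro x
    refine Finset.sum_congr rfl fun μ _ => ?_
    have h1 : K x (x + Pi.single μ 1) = K 0 (Pi.single μ 1) := by
      rw [← hT' 0 (Pi.single μ 1) x, zero_add, add_comm (Pi.single μ 1) x]
    have h2 : K x (x - Pi.single μ 1) = K 0 (-Pi.single μ 1) := by
      rw [← hT' 0 (-Pi.single μ 1) x, zero_add, neg_add_eq_sub]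
    rw [h1, h2]
  have hcard : (Fintype.card (TorusSite ν L) : ℝ) = (L : ℝ) ^ ν := by
    rw [Literature.Probability.LatticeModels.card_torusSite]; push_cast; rfl
  have hLpos : (0 : ℝ) < (L : ℝ) ^ ν := by
    have : (0 : ℝ) < L := Nat.cast_pos.mpr (Nat.pos_of_ne_zero (NeZero.ne L))
    positivity
  -- the Schwinger–Dyson bound at `β` and the linear lower bound for its constant
  have hSD := schwingerDyson_bound (N := N) (ν := ν) (L := L) hN1 hN4 (by omega) hL hβ
    (hval β hβ (hβ0.trans_le (min_le_right _ _)))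
  have hlow := hlin β hβ (hβ0.trans_le (min_le_left _ _))
  show (2 * N : ℝ) ^ 2 * (1 / ComplexSpin.sdK N (ComplexSpin.uNLogCoeff N) - C / (2 * N : ℝ) ^ 2 * β) ≤
    ((L : ℝ) ^ ν)⁻¹ * ∑ x : TorusSite ν L, ∑ μ : Fin ν, (K x (x + Pi.single μ 1) + K x (x - Pi.single μ 1))
  simp_rw [hnn]
  rw [Finset.sum_const, Finset.card_univ, nsmul_eq_mul, hcard, ← mul_assoc, inv_mul_cancel₀ hLpos.ne',
    one_mul]
  have hN' : (N : ℝ) ≠ 0 := Nat.cast_ne_zero.mpr hN0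
  calc (2 * N : ℝ) ^ 2 * (1 / ComplexSpin.sdK N (ComplexSpin.uNLogCoeff N) - C / (2 * N : ℝ) ^ 2 * β)
      = (2 * N : ℝ) ^ 2 / ComplexSpin.sdK N (ComplexSpin.uNLogCoeff N) - C * β := by
        field_simp
    _ ≤ sdBound N ν β := hlow
    _ ≤ _ := hSD

end Summit.QuantumFields.QCD.Theorems.SmallBetaInfraredSplit
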